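import Literature.Geometry.Lorentzian.KerrSchildDivergence
import HarnessLib

/-!
# Oblate-spheroidal calculus in the Kerr–Schild chart: the latitude `χ = z/r`, gradients and
# flat Laplacians of `r` and `χ`

(family `gr`; infrastructure for separated solutions of `□_g ψ = μ² ψ` on Kerr; namespace
`Literature.Geometry.Lorentzian.Kerr`)

In ingoing Kerr–Schild Cartesian coordinates `(t*, x, y, z)` the Kerr–Schild radius `r` and the
**latitude cosine** `χ = cos θ = z/r` (`Kerr.latitude`) are the first two of the oblate spheroidal
coordinates `(r, θ, φ̃)` adapted to the principal null congruence, `x + iy = (r + ia) e^{iφ̃} sin θ`,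
`z = r cos θ` (Kerr 1963; Visser arXiv:0706.0622, (35)–(36)). For the flat spatial metric these are
orthogonal coordinates with `|∇r|² = (r² + a²)/Σ`, `∇r·∇χ = 0`, `|∇χ|² = (1 − χ²)/Σ`,
`Δr = 2r/Σ`, `Δχ = −2χ/Σ`, `Σ = r² + a²χ²` (the oblate-spheroidal Laplacian
`Δ = Σ⁻¹(∂_r (r² + a²) ∂_r + ∂_χ (1 − χ²) ∂_χ + …)`; Flammer 1957, Ch. 2; Morse–Feshbach §5.1), and
both are constant-rate resp. constant along the straight null lines of `ℓ♯`:
`∂_{ℓ♯} r = 1`, `∂_{ℓ♯} χ = 0`, `∂²_{ℓ♯ℓ♯} r = ∂²_{ℓ♯ℓ♯} χ = 0`. This file proves these identities for the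
prelude's `Kerr.radius` on `E4` at every point with `r > 0`, with all derivatives Fréchet
derivatives on `E4` (second partials as derivatives of the explicit first partials
`fderiv_radius_basisVector_succ` along coordinate lines). They are the geometric input of the
separation of variables for axisymmetric profiles `F(r) S(χ)` (`KerrSeparatedProfile.lean`).

## References

* M. Visser, *The Kerr spacetime: a brief introduction*, arXiv:0706.0622, (33)–(36) (key
  `arXiv07060622`).
* R. P. Kerr, A. Schild, 1965, §2 (key `KerrSchild1965`).
-/

noncomputable section

open Set Filter
open scoped Topology

namespace Literature.Geometry.Lorentzian.Kerr

variable {a : ℝ} {x : E4}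

/-! ### The latitude cosine `χ = z/r` -/

/-- The **latitude cosine** `χ = cos θ = z/r` of the oblate spheroidal coordinates adapted to the
Kerr–Schild chart (`z = r cos θ`; Visser arXiv:0706.0622, (36)); `|χ| ≤ 1` wherever `r > 0`. Junk
value `0` on the disc `r = 0`. [cite: arXiv07060622, (36)] -/
def latitude (a : ℝ) (x : E4) : ℝ := x 3 / radius a x

/-- `χ² ≤ 1` wherever `r > 0` (`r² − z² = r²(x² + y²)/(r² + a²) ≥ 0` by the quartic). [cite: arXiv07060622, (35)] -/
theorem sq_latitude_le_one (hx : 0 < radius a x) : latitude a x ^ 2 ≤ 1 := by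
  have hq := radius_quartic a x
  rw [E4.spatialNorm_sq] at hq
  have key : (radius a x ^ 2 - x 3 ^ 2) * (radius a x ^ 2 + a ^ 2) =
      radius a x ^ 2 * (x 1 ^ 2 + x 2 ^ 2) := by linear_combination hq
  have hpos : 0 < radius a x ^ 2 + a ^ 2 := by positivity
  have hnn : 0 ≤ radius a x ^ 2 - x 3 ^ 2 := by
    by_contra h
    push Not at h
    have h1 : (radius a x ^ 2 - x 3 ^ 2) * (radius a x ^ 2 + a ^ 2) < 0 := mul_neg_of_neg_of_pos h hpos
    have h2 : 0 ≤ radius a x ^ 2 * (x 1 ^ 2 + x 2 ^ 2) := by positivity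
    linarith
  rw [latitude, div_pow, div_le_one (by positivity)]
  linarith

/-- `χ ∈ [−1, 1]` wherever `r > 0`. [cite: arXiv07060622, (35)] -/
theorem abs_latitude_le_one (hx : 0 < radius a x) : |latitude a x| ≤ 1 :=
  abs_le_one_iff_mul_self_le_one.2 (by nlinarith [sq_latitude_le_one hx])

/-- The latitude is invariant under `t*`-translations. [folklore] -/
theorem latitude_add_smul_basisVector_zero (a : ℝ) (x : E4) (t : ℝ) :
    latitude a (x + t • E4.basisVector 0) = latitude a x := by
  have h3 : (x + t • E4.basisVector 0) 3 = x 3 := by simp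
  rw [latitude, latitude, radius_add_time_smul_basisVector, h3]

/-- The latitude is `Cⁿ` (every `n ≤ ω`) wherever `r > 0`. [folklore] -/
theorem contDiffAt_latitude (hx : 0 < radius a x) {n : WithTop ℕ∞} :
    ContDiffAt ℝ n (latitude a) x :=
  (contDiff_coord 3).contDiffAt.div (contDiffAt_radius hx) hx.ne'

/-- Near `s = 0` the points of any line `x + s v` through a point with `r > 0` have `r > 0`.
[folklore] -/
theorem eventually_radius_line_pos (hx : 0 < radius a x) (v : E4) :
    ∀ᶠ s : ℝ in 𝓝 0, 0 < radius a (x + s • v) := by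
  have hc : Continuous fun s : ℝ ↦ radius a (x + s • v) :=
    (continuous_radius a).comp (continuous_const.add (continuous_id.smul continuous_const))
  have h0 : (0 : ℝ) < radius a (x + (0 : ℝ) • v) := by simpa using hx
  exact hc.continuousAt.preimage_mem_nhds (Ioi_mem_nhds h0)

/-- **The derivative of the latitude**: `dχ(v) = (v³ − χ dr(v))/r` wherever `r > 0`
(quotient rule along the line `x + sv`). [folklore] -/
theorem fderiv_latitude_apply (hx : 0 < radius a x) (v : E4) :
    fderiv ℝ (latitude a) x v = (v 3 - latitude a x * fderiv ℝ (radius a) x v) / radius a x := by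
  have hd : DifferentiableAt ℝ (latitude a) x :=
    (contDiffAt_latitude hx (n := 1)).differentiableAt one_ne_zero
  have h1 : HasLineDerivAt ℝ (latitude a) (fderiv ℝ (latitude a) x v) x v :=
    hd.hasFDerivAt.hasLineDerivAt _
  refine h1.unique ?_
  show HasDerivAt (fun t : ℝ ↦ latitude a (x + t • v)) _ 0
  have hr := hasDerivAt_radius_line hx v
  have hnum : HasDerivAt (fun t : ℝ ↦ x 3 + t * v 3) (v 3) 0 := by
    simpa using ((hasDerivAt_id (0 : ℝ)).mul_const (v 3)).const_add (x 3)
  have hdiv := hnum.div hr (by simpa using hx.ne')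
  have hfun : (fun t : ℝ ↦ latitude a (x + t • v)) = fun t ↦ (x 3 + t * v 3) / radius a (x + t • v) := by
    funext t
    simp [latitude]
  rw [hfun]
  refine hdiv.congr_deriv ?_
  simp only [zero_smul, add_zero, zero_mul, latitude]
  field_simp

/-- **`∂_{ℓ♯} χ = 0`**: the latitude is constant along the null lines (`(ℓ♯)³ = z/r = χ` and
`∂_{ℓ♯} r = 1`). Geometrically: `θ` is constant along the principal null congruence.
[cite: KerrSchild1965, §2] -/
theorem fderiv_latitude_nullVector (hx : 0 < radius a x) :
    fderiv ℝ (latitude a) x (nullVector a x) = 0 := by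
  rw [fderiv_latitude_apply hx, fderiv_radius_nullVector hx, nullVector_apply_three,
    nullCovectorFun_apply_three, latitude]
  simp

/-- Along the null line, `χ(x + s ℓ♯ₓ) = χ(x)` for `r(x) + s > 0`. [cite: KerrSchild1965, §2] -/
theorem latitude_add_smul_nullVector (hx : 0 < radius a x) {s : ℝ} (hs : 0 < radius a x + s) :
    latitude a (x + s • nullVector a x) = latitude a x := by
  rw [latitude, latitude, radius_add_smul_nullVector hx hs, add_smul_nullVector_apply,
    nullVector_apply_three, nullCovectorFun_apply_three]
  have hr : radius a x ≠ 0 := hx.ne'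
  field_simp

/-! ### Second derivatives along the null lines vanish -/

/-- `y ↦ dr_y(w)` is differentiable wherever `r > 0` (the radius is `C^∞` there). [folklore] -/
theorem differentiableAt_fderiv_radius_apply (hx : 0 < radius a x) (w : E4) :
    DifferentiableAt ℝ (fun y ↦ fderiv ℝ (radius a) y w) x := by
  have h2 : DifferentiableAt ℝ (fderiv ℝ (radius a)) x :=
    ((contDiffAt_radius hx (n := 2)).fderiv_right (m := 1) le_rfl).differentiableAt one_ne_zero
  exact h2.clm_apply (differentiableAt_const w)

/-- `y ↦ dχ_y(w)` is differentiable wherever `r > 0`. [folklore] -/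
theorem differentiableAt_fderiv_latitude_apply (hx : 0 < radius a x) (w : E4) :
    DifferentiableAt ℝ (fun y ↦ fderiv ℝ (latitude a) y w) x := by
  have h2 : DifferentiableAt ℝ (fderiv ℝ (latitude a)) x :=
    ((contDiffAt_latitude hx (n := 2)).fderiv_right (m := 1) le_rfl).differentiableAt one_ne_zero
  exact h2.clm_apply (differentiableAt_const w)

/-- For a function `C²` at `x`, `D²f(x)(v, w) = ∂_v (y ↦ Df(y) w)(x)`. [folklore] -/
theorem fderiv_fderiv_apply_eq {f : E4 → ℝ} (hf : ContDiffAt ℝ 2 f x) (v w : E4) :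
    fderiv ℝ (fderiv ℝ f) x v w = fderiv ℝ (fun y ↦ fderiv ℝ f y w) x v := by
  have h2 : DifferentiableAt ℝ (fderiv ℝ f) x :=
    (hf.fderiv_right (m := 1) le_rfl).differentiableAt one_ne_zero
  have := h2.hasFDerivAt.clm_apply (hasFDerivAt_const w x)
  rw [this.fderiv]
  simp

/-- **`∂²_{ℓ♯ℓ♯} r = 0`**: along its null line the radius is affine, `r(x + sℓ♯) = r(x) + s`, so the
line derivative of `y ↦ dr_y(ℓ♯ₓ)` along `ℓ♯ₓ` vanishes (`ℓ♯` is constant along the line).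
[cite: KerrSchild1965, §2] -/
theorem fderiv_fderiv_radius_nullVector (hx : 0 < radius a x) :
    fderiv ℝ (fun y ↦ fderiv ℝ (radius a) y (nullVector a x)) x (nullVector a x) = 0 := by
  have h1 : HasLineDerivAt ℝ (fun y ↦ fderiv ℝ (radius a) y (nullVector a x))
      (fderiv ℝ (fun y ↦ fderiv ℝ (radius a) y (nullVector a x)) x (nullVector a x)) x
      (nullVector a x) :=
    (differentiableAt_fderiv_radius_apply hx _).hasFDerivAt.hasLineDerivAt _
  refine h1.unique ?_
  show HasDerivAt (fun s : ℝ ↦ fderiv ℝ (radius a) (x + s • nullVector a x) (nullVector a x)) 0 0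
  have hev : (fun s : ℝ ↦ fderiv ℝ (radius a) (x + s • nullVector a x) (nullVector a x)) =ᶠ[𝓝 0]
      fun _ ↦ (1 : ℝ) := by
    filter_upwards [eventually_radius_add_pos hx] with s hs
    have hxs : 0 < radius a (x + s • nullVector a x) := by rwa [radius_add_smul_nullVector hx hs]
    have := fderiv_radius_nullVector hxs
    rwa [nullVector_add_smul_nullVector hx hs] at this
  exact (hasDerivAt_const (0 : ℝ) (1 : ℝ)).congr_of_eventuallyEq hev

/-- **`∂²_{ℓ♯ℓ♯} χ = 0`**: the latitude is constant along the null lines. [cite: KerrSchild1965, §2] -/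
theorem fderiv_fderiv_latitude_nullVector (hx : 0 < radius a x) :
    fderiv ℝ (fun y ↦ fderiv ℝ (latitude a) y (nullVector a x)) x (nullVector a x) = 0 := by
  have h1 : HasLineDerivAt ℝ (fun y ↦ fderiv ℝ (latitude a) y (nullVector a x))
      (fderiv ℝ (fun y ↦ fderiv ℝ (latitude a) y (nullVector a x)) x (nullVector a x)) x
      (nullVector a x) :=
    (differentiableAt_fderiv_latitude_apply hx _).hasFDerivAt.hasLineDerivAt _
  refine h1.unique ?_
  show HasDerivAt (fun s : ℝ ↦ fderiv ℝ (latitude a) (x + s • nullVector a x) (nullVector a x)) 0 0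
  have hev : (fun s : ℝ ↦ fderiv ℝ (latitude a) (x + s • nullVector a x) (nullVector a x)) =ᶠ[𝓝 0]
      fun _ ↦ (0 : ℝ) := by
    filter_upwards [eventually_radius_add_pos hx] with s hs
    have hxs : 0 < radius a (x + s • nullVector a x) := by rwa [radius_add_smul_nullVector hx hs]
    have := fderiv_latitude_nullVector hxs
    rwa [nullVector_add_smul_nullVector hx hs] at this
  exact (hasDerivAt_const (0 : ℝ) (0 : ℝ)).congr_of_eventuallyEq hev

/-- `D²r(ℓ♯, ℓ♯) = 0` in Fréchet form. [cite: KerrSchild1965, §2] -/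
theorem fderiv_fderiv_radius_nullVector_nullVector (hx : 0 < radius a x) :
    fderiv ℝ (fderiv ℝ (radius a)) x (nullVector a x) (nullVector a x) = 0 := by
  rw [fderiv_fderiv_apply_eq (contDiffAt_radius hx), fderiv_fderiv_radius_nullVector hx]

/-- `D²χ(ℓ♯, ℓ♯) = 0` in Fréchet form. [cite: KerrSchild1965, §2] -/
theorem fderiv_fderiv_latitude_nullVector_nullVector (hx : 0 < radius a x) :
    fderiv ℝ (fderiv ℝ (latitude a)) x (nullVector a x) (nullVector a x) = 0 := by
  rw [fderiv_fderiv_apply_eq (contDiffAt_latitude hx), fderiv_fderiv_latitude_nullVector hx]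

/-! ### First-order identities: `|∇r|² = (r² + a²)/Σ`, `∇r·∇χ = 0`, `|∇χ|² = (1 − χ²)/Σ` -/

/-- The three numerators `N_i = r² xⁱ⁺¹ + δ_{i2} a² z` of the partials `∂_{i+1} r = N_i/(rΣ)`.
[cite: arXiv07060622, (35)] -/
def radiusNum (a : ℝ) (x : E4) (i : Fin 3) : ℝ :=
  radius a x ^ 2 * x i.succ + if i = 2 then a ^ 2 * x 3 else 0

/-- `∂_{i+1} r · (rΣ) = N_i`. [cite: arXiv07060622, (35)] -/
theorem fderiv_radius_basisVector_succ_mul (hx : 0 < radius a x) (i : Fin 3) :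
    fderiv ℝ (radius a) x (E4.basisVector i.succ) * (radius a x * blSigma a (E4.spatial x)) =
      radiusNum a x i := by
  rw [fderiv_radius_basisVector_succ hx i, radiusNum,
    div_mul_cancel₀ _ (mul_ne_zero hx.ne' (blSigma_spatial_pos hx).ne')]

/-- `∑ N_i² = (r² + a²) r² Σ` (`normSq_radiusGrad_alg` at a point of `E4`). [cite: arXiv07060622, (35)] -/
theorem sum_sq_radiusNum (x : E4) (a : ℝ) :
    ∑ i : Fin 3, radiusNum a x i ^ 2 =
      (radius a x ^ 2 + a ^ 2) * (radius a x ^ 2 * blSigma a (E4.spatial x)) := by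
  have hq := radius_quartic a x
  rw [E4.spatialNorm_sq] at hq
  have h := normSq_radiusGrad_alg (radius a x) (a ^ 2) (x 1) (x 2) (x 3) hq
  rw [blSigma_spatial_eq, E4.spatialNorm_sq, Fin.sum_univ_three]
  simp only [radiusNum, Fin.isValue, Fin.succ_zero_eq_one, Fin.succ_one_eq_two,
    fin_succ_two_eq_three, Fin.reduceEq, ↓reduceIte, add_zero]
  linear_combination h

/-- `∑ xⁱ⁺¹ N_i = r²(r² + a²)` (by the quartic). [cite: arXiv07060622, (35)] -/
theorem sum_coord_mul_radiusNum (x : E4) (a : ℝ) :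
    ∑ i : Fin 3, x i.succ * radiusNum a x i = radius a x ^ 2 * (radius a x ^ 2 + a ^ 2) := by
  have hq := radius_quartic a x
  rw [E4.spatialNorm_sq] at hq
  rw [Fin.sum_univ_three]
  simp only [radiusNum, Fin.isValue, Fin.succ_zero_eq_one, Fin.succ_one_eq_two,
    fin_succ_two_eq_three, Fin.reduceEq, ↓reduceIte, add_zero]
  linear_combination (-1 : ℝ) * hq

/-- **`|∇r|² = (r² + a²)/Σ`** on `E4`: `∑_{i} (∂_{i+1} r)² = (r² + a²)/Σ` wherever `r > 0` (the flat
metric has `η^{rr} = (r² + a²)/Σ` in oblate spheroidal coordinates). [cite: arXiv07060622, (35)] -/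
theorem sum_sq_fderiv_radius (hx : 0 < radius a x) :
    ∑ i : Fin 3, fderiv ℝ (radius a) x (E4.basisVector i.succ) ^ 2 =
      (radius a x ^ 2 + a ^ 2) / blSigma a (E4.spatial x) := by
  have hS := blSigma_spatial_pos hx
  have hD : radius a x * blSigma a (E4.spatial x) ≠ 0 := by positivity
  have h : ∀ i : Fin 3, fderiv ℝ (radius a) x (E4.basisVector i.succ) =
      radiusNum a x i / (radius a x * blSigma a (E4.spatial x)) := fun i ↦ by
    rw [eq_div_iff hD, fderiv_radius_basisVector_succ_mul hx i]
  simp only [h, div_pow, ← Finset.sum_div, sum_sq_radiusNum]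
  field_simp

/-- **`∇r · ∇χ = 0`**: `r` and `χ` are orthogonal coordinates for the flat metric. [cite: arXiv07060622, (35)–(36)] -/
theorem sum_fderiv_radius_mul_fderiv_latitude (hx : 0 < radius a x) :
    ∑ i : Fin 3, fderiv ℝ (radius a) x (E4.basisVector i.succ) *
      fderiv ℝ (latitude a) x (E4.basisVector i.succ) = 0 := by
  have hr : radius a x ≠ 0 := hx.ne'
  have hS := blSigma_spatial_pos hx
  have hG := sum_sq_fderiv_radius hx
  have h3 : fderiv ℝ (radius a) x (E4.basisVector 3) =
      x 3 * (radius a x ^ 2 + a ^ 2) / (radius a x * blSigma a (E4.spatial x)) := by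
    rw [fderiv_radius_basisVector_three hx]; ring
  -- rewrite each `dχ(e_{i+1})`
  have hsum : ∑ i : Fin 3, fderiv ℝ (radius a) x (E4.basisVector i.succ) *
      fderiv ℝ (latitude a) x (E4.basisVector i.succ) =
      (fderiv ℝ (radius a) x (E4.basisVector 3) -
        latitude a x * ∑ i : Fin 3, fderiv ℝ (radius a) x (E4.basisVector i.succ) ^ 2) /
        radius a x := by
    simp only [fderiv_latitude_apply hx, Fin.sum_univ_three]
    simp [E4.basisVector, Fin.succ_zero_eq_one, Fin.succ_one_eq_two, fin_succ_two_eq_three]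
    field_simp
    ring
  rw [hsum, hG, h3, latitude]
  field_simp
  ring

/-- **`|∇χ|² = (1 − χ²)/Σ`** (`η^{θθ} = 1/Σ` and `χ = cos θ`). [cite: arXiv07060622, (35)–(36)] -/
theorem sum_sq_fderiv_latitude (hx : 0 < radius a x) :
    ∑ i : Fin 3, fderiv ℝ (latitude a) x (E4.basisVector i.succ) ^ 2 =
      (1 - latitude a x ^ 2) / blSigma a (E4.spatial x) := by
  have hr : radius a x ≠ 0 := hx.ne'
  have hS := blSigma_spatial_pos hx
  have hG := sum_sq_fderiv_radius hx
  have h1 := sq_mul_blSigma_spatial a x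
  have h3 : fderiv ℝ (radius a) x (E4.basisVector 3) =
      x 3 * (radius a x ^ 2 + a ^ 2) / (radius a x * blSigma a (E4.spatial x)) := by
    rw [fderiv_radius_basisVector_three hx]; ring
  have hsum : ∑ i : Fin 3, fderiv ℝ (latitude a) x (E4.basisVector i.succ) ^ 2 =
      (1 - 2 * latitude a x * fderiv ℝ (radius a) x (E4.basisVector 3) +
        latitude a x ^ 2 * ∑ i : Fin 3, fderiv ℝ (radius a) x (E4.basisVector i.succ) ^ 2) /
        radius a x ^ 2 := by
    simp only [fderiv_latitude_apply hx, Fin.sum_univ_three]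
    simp [E4.basisVector, Fin.succ_zero_eq_one, Fin.succ_one_eq_two, fin_succ_two_eq_three]
    field_simp
    ring
  rw [hsum, hG, h3, latitude]
  rw [div_eq_div_iff (by positivity) hS.ne']
  field_simp
  linear_combination h1

/-! ### Second partials of `r` along coordinate lines and the flat Laplacian `Δr = 2r/Σ` -/

/-- `‖(x + s ∂_{i+1})⃗‖² = ‖x⃗‖² + 2 s xⁱ⁺¹ + s²`. [folklore] -/
theorem spatialNorm_sq_add_smul_basisVector_succ (x : E4) (s : ℝ) (i : Fin 3) :
    E4.spatialNorm (x + s • E4.basisVector i.succ) ^ 2 =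
      E4.spatialNorm x ^ 2 + 2 * s * x i.succ + s ^ 2 := by
  rw [E4.spatialNorm_sq, E4.spatialNorm_sq]
  simp only [add_smul_basisVector_apply]
  fin_cases i <;> simp <;> ring

/-- `(x + s ∂_{i+1})ⁱ⁺¹ = xⁱ⁺¹ + s`. [folklore] -/
theorem add_smul_basisVector_succ_apply_self (x : E4) (s : ℝ) (i : Fin 3) :
    (x + s • E4.basisVector i.succ) i.succ = x i.succ + s := by
  rw [add_smul_basisVector_apply, if_pos rfl]

/-- `(x + s ∂_{i+1})³ = x³ + δ_{i2} s`. [folklore] -/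
theorem add_smul_basisVector_succ_apply_three (x : E4) (s : ℝ) (i : Fin 3) :
    (x + s • E4.basisVector i.succ) 3 = x 3 + if i = 2 then s else 0 := by
  rw [add_smul_basisVector_apply]
  fin_cases i <;> simp

/-- The coefficient `c_i = δ_{i2} a²` of `z` in the numerator `N_i`. [folklore] -/
def radiusNumCoeff (a : ℝ) (i : Fin 3) : ℝ := if i = 2 then a ^ 2 else 0

/-- `N_i = r² xⁱ⁺¹ + c_i z`. [folklore] -/
theorem radiusNum_eq (a : ℝ) (x : E4) (i : Fin 3) :
    radiusNum a x i = radius a x ^ 2 * x i.succ + radiusNumCoeff a i * x 3 := by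
  unfold radiusNum radiusNumCoeff
  split_ifs <;> ring

/-- `∑ c_i = a²`. [folklore] -/
theorem sum_radiusNumCoeff (a : ℝ) : ∑ i : Fin 3, radiusNumCoeff a i = a ^ 2 := by
  simp [radiusNumCoeff]

/-- The `z`-term of `∂_{i+1} r` along the line `x + s∂_{i+1}`:
`δ_{i2} a² (x + s∂_{i+1})³ = c_i (x³ + s)`. [folklore] -/
theorem ite_numerator_line (a : ℝ) (x : E4) (s : ℝ) (i : Fin 3) :
    (if i = 2 then a ^ 2 * (x + s • E4.basisVector i.succ) 3 else 0) =
      radiusNumCoeff a i * (x 3 + s) := by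
  rw [add_smul_basisVector_succ_apply_three]
  unfold radiusNumCoeff
  split_ifs <;> ring

/-- `(∂_{i+1})³ = δ_{i2}`. [folklore] -/
theorem basisVector_succ_apply_three (i : Fin 3) :
    (E4.basisVector i.succ : E4) 3 = if i = 2 then 1 else 0 := by
  fin_cases i <;> simp [E4.basisVector]

/-- **The second partial `∂_{i+1}∂_{i+1} r` as a line derivative.** Along the coordinate line
`s ↦ x + s ∂_{i+1}` the first partial `∂_{i+1} r = N_i/(rΣ)` (`fderiv_radius_basisVector_succ`) has
`s`-derivative `(A_i rΣ − N_i B_i)/(rΣ)²` at `s = 0`, with `A_i = 2 r xⁱ⁺¹ ∂_{i+1}r + r² + c_i`,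
`B_i = Σ ∂_{i+1}r + r(4 r ∂_{i+1}r − 2 xⁱ⁺¹)` (quotient rule; `Σ = 2r² − ‖x⃗‖² + a²`).
[cite: arXiv07060622, (35)] -/
theorem hasDerivAt_fderiv_radius_line (hx : 0 < radius a x) (i : Fin 3) :
    HasDerivAt (fun s : ℝ ↦ fderiv ℝ (radius a) (x + s • E4.basisVector i.succ) (E4.basisVector i.succ))
      (((2 * radius a x * x i.succ * fderiv ℝ (radius a) x (E4.basisVector i.succ) + radius a x ^ 2 +
          radiusNumCoeff a i) * (radius a x * blSigma a (E4.spatial x)) -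
        radiusNum a x i * (blSigma a (E4.spatial x) * fderiv ℝ (radius a) x (E4.basisVector i.succ) +
          radius a x * (4 * radius a x * fderiv ℝ (radius a) x (E4.basisVector i.succ) - 2 * x i.succ))) /
        (radius a x * blSigma a (E4.spatial x)) ^ 2) 0 := by
  have hr := hasDerivAt_radius_line hx (E4.basisVector i.succ)
  have hD : radius a x * blSigma a (E4.spatial x) ≠ 0 :=
    mul_ne_zero hx.ne' (blSigma_spatial_pos hx).ne'
  -- the explicit quotient along the line, valid near `s = 0`
  have hev : (fun s : ℝ ↦ fderiv ℝ (radius a) (x + s • E4.basisVector i.succ) (E4.basisVector i.succ))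
      =ᶠ[𝓝 0] fun s ↦
      (radius a (x + s • E4.basisVector i.succ) ^ 2 * (x i.succ + s) + radiusNumCoeff a i * (x 3 + s)) /
        (radius a (x + s • E4.basisVector i.succ) * (2 * radius a (x + s • E4.basisVector i.succ) ^ 2 -
          (E4.spatialNorm x ^ 2 + 2 * s * x i.succ + s ^ 2) + a ^ 2)) := by
    filter_upwards [eventually_radius_line_pos hx (E4.basisVector i.succ)] with s hs
    rw [fderiv_radius_basisVector_succ hs i, blSigma_spatial_eq,
      spatialNorm_sq_add_smul_basisVector_succ, add_smul_basisVector_succ_apply_self,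
      ite_numerator_line]
  -- derivative of the explicit quotient
  have hnum : HasDerivAt (fun s : ℝ ↦ radius a (x + s • E4.basisVector i.succ) ^ 2 * (x i.succ + s) +
      radiusNumCoeff a i * (x 3 + s))
      (2 * radius a x * x i.succ * fderiv ℝ (radius a) x (E4.basisVector i.succ) + radius a x ^ 2 +
        radiusNumCoeff a i) 0 := by
    have h1 := (hr.pow 2).mul ((hasDerivAt_id (0 : ℝ)).const_add (x i.succ))
    have h2 := ((hasDerivAt_id (0 : ℝ)).const_add (x 3)).const_mul (radiusNumCoeff a i)
    refine (h1.add h2).congr_deriv ?_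
    simp
    ring
  have hden : HasDerivAt (fun s : ℝ ↦ radius a (x + s • E4.basisVector i.succ) *
      (2 * radius a (x + s • E4.basisVector i.succ) ^ 2 -
        (E4.spatialNorm x ^ 2 + 2 * s * x i.succ + s ^ 2) + a ^ 2))
      (blSigma a (E4.spatial x) * fderiv ℝ (radius a) x (E4.basisVector i.succ) +
        radius a x * (4 * radius a x * fderiv ℝ (radius a) x (E4.basisVector i.succ) - 2 * x i.succ)) 0 := by
    have hP : HasDerivAt (fun s : ℝ ↦ E4.spatialNorm x ^ 2 + 2 * s * x i.succ + s ^ 2)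
        (2 * x i.succ) 0 := by
      have := (((hasDerivAt_id (0 : ℝ)).const_mul 2).mul_const (x i.succ)).const_add
        (E4.spatialNorm x ^ 2) |>.add (hasDerivAt_pow 2 (0 : ℝ))
      refine this.congr_deriv ?_
      simp
    have hbr := (((hr.pow 2).const_mul 2).sub hP).add_const (a ^ 2)
    refine (hr.mul hbr).congr_deriv ?_
    simp [blSigma_spatial_eq]
    ring
  have hden0 : radius a (x + (0 : ℝ) • E4.basisVector i.succ) *
      (2 * radius a (x + (0 : ℝ) • E4.basisVector i.succ) ^ 2 -
        (E4.spatialNorm x ^ 2 + 2 * 0 * x i.succ + 0 ^ 2) + a ^ 2) ≠ 0 := by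
    simpa [blSigma_spatial_eq] using hD
  have hdiv := hnum.div hden hden0
  refine (hdiv.congr_of_eventuallyEq hev).congr_deriv ?_
  simp [blSigma_spatial_eq, radiusNum_eq]

/-- **`∂_{i+1}∂_{i+1} r`** wherever `r > 0`: the line derivative of `hasDerivAt_fderiv_radius_line`
is the second partial (uniqueness of line derivatives of the `C^∞` function `y ↦ ∂_{i+1} r`).
[cite: arXiv07060622, (35)] -/
theorem fderiv_fderiv_radius_basisVector_succ (hx : 0 < radius a x) (i : Fin 3) :
    fderiv ℝ (fun y ↦ fderiv ℝ (radius a) y (E4.basisVector i.succ)) x (E4.basisVector i.succ) =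
      ((2 * radius a x * x i.succ * fderiv ℝ (radius a) x (E4.basisVector i.succ) + radius a x ^ 2 +
          radiusNumCoeff a i) * (radius a x * blSigma a (E4.spatial x)) -
        radiusNum a x i * (blSigma a (E4.spatial x) * fderiv ℝ (radius a) x (E4.basisVector i.succ) +
          radius a x * (4 * radius a x * fderiv ℝ (radius a) x (E4.basisVector i.succ) - 2 * x i.succ))) /
        (radius a x * blSigma a (E4.spatial x)) ^ 2 := by
  have h1 : HasLineDerivAt ℝ (fun y ↦ fderiv ℝ (radius a) y (E4.basisVector i.succ))
      (fderiv ℝ (fun y ↦ fderiv ℝ (radius a) y (E4.basisVector i.succ)) x (E4.basisVector i.succ)) x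
      (E4.basisVector i.succ) :=
    (differentiableAt_fderiv_radius_apply hx _).hasFDerivAt.hasLineDerivAt _
  exact h1.unique (hasDerivAt_fderiv_radius_line hx i)

/-- The polynomial identity behind `Δr = 2r/Σ`: with `g_i rΣ = N_i`, `∑ N_i² = (r² + a²) r²Σ`,
`∑ xⁱ N_i = r²(r² + a²)` and `∑ c_i = a²`, the sum of the three numerators of the second partials
is `2r³Σ` (multiply by `rΣ`). [folklore] -/
theorem laplacian_radius_alg (r S b X₁ X₂ X₃ g₁ g₂ g₃ N₁ N₂ N₃ c₁ c₂ c₃ : ℝ) (hr : r ≠ 0)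
    (hS : S ≠ 0) (hg₁ : g₁ * (r * S) = N₁) (hg₂ : g₂ * (r * S) = N₂) (hg₃ : g₃ * (r * S) = N₃)
    (hB : N₁ ^ 2 + N₂ ^ 2 + N₃ ^ 2 = (r ^ 2 + b) * (r ^ 2 * S))
    (hC : X₁ * N₁ + X₂ * N₂ + X₃ * N₃ = r ^ 2 * (r ^ 2 + b)) (hc : c₁ + c₂ + c₃ = b) :
    ((2 * r * X₁ * g₁ + r ^ 2 + c₁) * (r * S) - N₁ * (S * g₁ + r * (4 * r * g₁ - 2 * X₁))) +
      ((2 * r * X₂ * g₂ + r ^ 2 + c₂) * (r * S) - N₂ * (S * g₂ + r * (4 * r * g₂ - 2 * X₂))) +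
      ((2 * r * X₃ * g₃ + r ^ 2 + c₃) * (r * S) - N₃ * (S * g₃ + r * (4 * r * g₃ - 2 * X₃))) =
      2 * r ^ 3 * S := by
  refine mul_left_cancel₀ (mul_ne_zero hr hS) ?_
  linear_combination 4 * r ^ 2 * S * hC - (S + 4 * r ^ 2) * hB +
    (2 * r ^ 2 * S * X₁ - (S + 4 * r ^ 2) * N₁) * hg₁ +
    (2 * r ^ 2 * S * X₂ - (S + 4 * r ^ 2) * N₂) * hg₂ +
    (2 * r ^ 2 * S * X₃ - (S + 4 * r ^ 2) * N₃) * hg₃ + r ^ 2 * S ^ 2 * hc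

/-- **The flat Laplacian of the Kerr–Schild radius: `Δr = ∑ᵢ ∂_{i+1}∂_{i+1} r = 2r/Σ`** wherever
`r > 0` (`Σ = r² + a² cos²θ`; the `r`-part of the flat Laplacian in oblate spheroidal coordinates is
`Σ⁻¹ ∂_r((r² + a²) ∂_r)`, whence `Δr = 2r/Σ`; for `a = 0`, `Δ|x⃗| = 2/|x⃗|`). Visser
arXiv:0706.0622, (35)–(36). [cite: arXiv07060622, (35)–(36)] -/
theorem laplacian_radius (hx : 0 < radius a x) :
    ∑ i : Fin 3, fderiv ℝ (fun y ↦ fderiv ℝ (radius a) y (E4.basisVector i.succ)) x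
      (E4.basisVector i.succ) = 2 * radius a x / blSigma a (E4.spatial x) := by
  have hr : radius a x ≠ 0 := hx.ne'
  have hS : blSigma a (E4.spatial x) ≠ 0 := (blSigma_spatial_pos hx).ne'
  have hD : (radius a x * blSigma a (E4.spatial x)) ^ 2 ≠ 0 := by positivity
  simp only [fderiv_fderiv_radius_basisVector_succ hx, Fin.sum_univ_three, ← add_div]
  rw [div_eq_div_iff hD hS]
  have hB := sum_sq_radiusNum x a
  have hC := sum_coord_mul_radiusNum x a
  have hc := sum_radiusNumCoeff a
  rw [Fin.sum_univ_three] at hB hC hc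
  have halg := laplacian_radius_alg (radius a x) (blSigma a (E4.spatial x)) (a ^ 2) (x 1) (x 2) (x 3)
    (fderiv ℝ (radius a) x (E4.basisVector 1)) (fderiv ℝ (radius a) x (E4.basisVector 2))
    (fderiv ℝ (radius a) x (E4.basisVector 3)) (radiusNum a x 0) (radiusNum a x 1) (radiusNum a x 2)
    (radiusNumCoeff a 0) (radiusNumCoeff a 1) (radiusNumCoeff a 2) hr hS
    (fderiv_radius_basisVector_succ_mul hx 0) (fderiv_radius_basisVector_succ_mul hx 1)
    (fderiv_radius_basisVector_succ_mul hx 2) hB hC hc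
  simp only [Fin.isValue, Fin.succ_zero_eq_one, Fin.succ_one_eq_two, fin_succ_two_eq_three] at halg ⊢
  rw [halg]
  ring

/-! ### The flat Laplacian of the latitude: `Δχ = −2χ/Σ` -/

/-- The line derivative of the latitude along any line is its Fréchet derivative. [folklore] -/
theorem hasDerivAt_latitude_line (hx : 0 < radius a x) (v : E4) :
    HasDerivAt (fun t : ℝ ↦ latitude a (x + t • v)) (fderiv ℝ (latitude a) x v) 0 :=
  ((contDiffAt_latitude hx (n := 1)).differentiableAt one_ne_zero).hasFDerivAt.hasLineDerivAt v

/-- **The second partial `∂_{i+1}∂_{i+1} χ` as a line derivative**: along `s ↦ x + s∂_{i+1}`,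
`∂_{i+1}χ = (δ_{i2} − χ ∂_{i+1}r)/r` (`fderiv_latitude_apply`) has `s`-derivative
`(−(∂_{i+1}χ · ∂_{i+1}r + χ ∂²_{i+1}r) r − (δ_{i2} − χ ∂_{i+1}r) ∂_{i+1}r)/r²` at `s = 0`. [folklore] -/
theorem hasDerivAt_fderiv_latitude_line (hx : 0 < radius a x) (i : Fin 3) :
    HasDerivAt (fun s : ℝ ↦ fderiv ℝ (latitude a) (x + s • E4.basisVector i.succ) (E4.basisVector i.succ))
      ((-(fderiv ℝ (latitude a) x (E4.basisVector i.succ) * fderiv ℝ (radius a) x (E4.basisVector i.succ) +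
          latitude a x * fderiv ℝ (fun y ↦ fderiv ℝ (radius a) y (E4.basisVector i.succ)) x
            (E4.basisVector i.succ)) * radius a x -
        ((if i = 2 then 1 else 0) - latitude a x * fderiv ℝ (radius a) x (E4.basisVector i.succ)) *
          fderiv ℝ (radius a) x (E4.basisVector i.succ)) / radius a x ^ 2) 0 := by
  have hr := hasDerivAt_radius_line hx (E4.basisVector i.succ)
  have hL := hasDerivAt_latitude_line hx (E4.basisVector i.succ)
  have hG := hasDerivAt_fderiv_radius_line hx i
  rw [← fderiv_fderiv_radius_basisVector_succ hx i] at hG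
  have hev : (fun s : ℝ ↦ fderiv ℝ (latitude a) (x + s • E4.basisVector i.succ) (E4.basisVector i.succ))
      =ᶠ[𝓝 0] fun s ↦
      ((if i = 2 then 1 else 0) - latitude a (x + s • E4.basisVector i.succ) *
        fderiv ℝ (radius a) (x + s • E4.basisVector i.succ) (E4.basisVector i.succ)) /
        radius a (x + s • E4.basisVector i.succ) := by
    filter_upwards [eventually_radius_line_pos hx (E4.basisVector i.succ)] with s hs
    rw [fderiv_latitude_apply hs, basisVector_succ_apply_three]
  have hnum : HasDerivAt (fun s : ℝ ↦ (if i = 2 then (1 : ℝ) else 0) -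
      latitude a (x + s • E4.basisVector i.succ) *
        fderiv ℝ (radius a) (x + s • E4.basisVector i.succ) (E4.basisVector i.succ))
      (-(fderiv ℝ (latitude a) x (E4.basisVector i.succ) * fderiv ℝ (radius a) x (E4.basisVector i.succ) +
        latitude a x * fderiv ℝ (fun y ↦ fderiv ℝ (radius a) y (E4.basisVector i.succ)) x
          (E4.basisVector i.succ))) 0 := by
    refine ((hL.mul hG).const_sub (if i = 2 then (1 : ℝ) else 0)).congr_deriv ?_
    simp
  have hdiv := hnum.div hr (by simpa using hx.ne')
  refine (hdiv.congr_of_eventuallyEq hev).congr_deriv ?_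
  simp only [zero_smul, add_zero]

/-- **`∂_{i+1}∂_{i+1} χ`** wherever `r > 0` (uniqueness of line derivatives). [folklore] -/
theorem fderiv_fderiv_latitude_basisVector_succ (hx : 0 < radius a x) (i : Fin 3) :
    fderiv ℝ (fun y ↦ fderiv ℝ (latitude a) y (E4.basisVector i.succ)) x (E4.basisVector i.succ) =
      (-(fderiv ℝ (latitude a) x (E4.basisVector i.succ) * fderiv ℝ (radius a) x (E4.basisVector i.succ) +
          latitude a x * fderiv ℝ (fun y ↦ fderiv ℝ (radius a) y (E4.basisVector i.succ)) x
            (E4.basisVector i.succ)) * radius a x -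
        ((if i = 2 then 1 else 0) - latitude a x * fderiv ℝ (radius a) x (E4.basisVector i.succ)) *
          fderiv ℝ (radius a) x (E4.basisVector i.succ)) / radius a x ^ 2 := by
  have h1 : HasLineDerivAt ℝ (fun y ↦ fderiv ℝ (latitude a) y (E4.basisVector i.succ))
      (fderiv ℝ (fun y ↦ fderiv ℝ (latitude a) y (E4.basisVector i.succ)) x (E4.basisVector i.succ)) x
      (E4.basisVector i.succ) :=
    (differentiableAt_fderiv_latitude_apply hx _).hasFDerivAt.hasLineDerivAt _
  exact h1.unique (hasDerivAt_fderiv_latitude_line hx i)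

/-- **The flat Laplacian of the latitude: `Δχ = ∑ᵢ ∂_{i+1}∂_{i+1} χ = −2χ/Σ`** wherever `r > 0`
(`Δ(cos θ) = −2 cos θ/Σ` from the `θ`-part `Σ⁻¹ (sin θ)⁻¹ ∂_θ(sin θ ∂_θ)` of the oblate-spheroidal
Laplacian). [cite: arXiv07060622, (35)–(36)] -/
theorem laplacian_latitude (hx : 0 < radius a x) :
    ∑ i : Fin 3, fderiv ℝ (fun y ↦ fderiv ℝ (latitude a) y (E4.basisVector i.succ)) x
      (E4.basisVector i.succ) = -(2 * latitude a x) / blSigma a (E4.spatial x) := by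
  have hr : radius a x ≠ 0 := hx.ne'
  have hS : blSigma a (E4.spatial x) ≠ 0 := (blSigma_spatial_pos hx).ne'
  have hperp := sum_fderiv_radius_mul_fderiv_latitude hx
  have hΔ := laplacian_radius hx
  have hG := sum_sq_fderiv_radius hx
  rw [Fin.sum_univ_three] at hperp hΔ hG
  have h3 : fderiv ℝ (radius a) x (E4.basisVector 3) =
      latitude a x * (radius a x ^ 2 + a ^ 2) / blSigma a (E4.spatial x) := by
    rw [fderiv_radius_basisVector_three hx, latitude]
    field_simp
  simp only [fderiv_fderiv_latitude_basisVector_succ hx, Fin.sum_univ_three]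
  simp only [Fin.isValue, Fin.succ_zero_eq_one, Fin.succ_one_eq_two, fin_succ_two_eq_three,
    Fin.reduceEq, ↓reduceIte] at hperp hΔ hG ⊢
  -- abbreviate the nine derivative values
  set g₁ := fderiv ℝ (radius a) x (E4.basisVector 1)
  set g₂ := fderiv ℝ (radius a) x (E4.basisVector 2)
  set g₃ := fderiv ℝ (radius a) x (E4.basisVector 3)
  set h₁ := fderiv ℝ (latitude a) x (E4.basisVector 1)
  set h₂ := fderiv ℝ (latitude a) x (E4.basisVector 2)
  set h₃ := fderiv ℝ (latitude a) x (E4.basisVector 3)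
  set v₁ := fderiv ℝ (fun y ↦ fderiv ℝ (radius a) y (E4.basisVector 1)) x (E4.basisVector 1)
  set v₂ := fderiv ℝ (fun y ↦ fderiv ℝ (radius a) y (E4.basisVector 2)) x (E4.basisVector 2)
  set v₃ := fderiv ℝ (fun y ↦ fderiv ℝ (radius a) y (E4.basisVector 3)) x (E4.basisVector 3)
  have key : (-(h₁ * g₁ + latitude a x * v₁) * radius a x - (0 - latitude a x * g₁) * g₁) / radius a x ^ 2 +
      (-(h₂ * g₂ + latitude a x * v₂) * radius a x - (0 - latitude a x * g₂) * g₂) / radius a x ^ 2 +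
      (-(h₃ * g₃ + latitude a x * v₃) * radius a x - (1 - latitude a x * g₃) * g₃) / radius a x ^ 2 =
      (-(radius a x) * (g₁ * h₁ + g₂ * h₂ + g₃ * h₃) - radius a x * latitude a x * (v₁ + v₂ + v₃)
        - (g₃ - latitude a x * (g₁ ^ 2 + g₂ ^ 2 + g₃ ^ 2))) / radius a x ^ 2 := by
    field_simp
    ring
  rw [key, hperp, hΔ, hG, h3]
  field_simp
  ring

end Literature.Geometry.Lorentzian.Kerr
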